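import Literature.AlgebraicGeometry.Resolution.CubeMonomialChartsStellar

/-!
# Simplicial toric cube charts making finitely many monomials pairwise comparable

Given a finite set `S ⊆ ℕⁿ` of exponent vectors, we construct finitely many exponent matrices
`A_c ∈ ℕ^{n×n}` with `det A_c ≠ 0` whose monomial maps `μ_{A_c} v = (∏ⱼ vⱼ^{A_c i j})ᵢ` have
pairwise disjoint images of the open unit cube `(0,1)ⁿ`, covering it up to a Lebesgue-null set,
such that on every chart the pulled-back exponent vectors `A_cᵀ a` (`a ∈ S`) are pairwise
comparable componentwise — i.e. after the monomial substitution one of any two monomials `y^a`,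
`y^b` (`a, b ∈ S`) divides the other (`exists_cube_charts_pairwise_comparable`).

In logarithmic coordinates this is a simplicial fan supported on the positive orthant refining the
hyperplane arrangement `⟨a - b, L⟩ = 0`.  The construction is the naive principalization of the
binomial ideals `(y^a, y^b)` by **weighted stellar subdivisions** (Goward-style): process the pairs
one at a time; while the form `⟨a - b, ·⟩` takes a positive value `α` on a ray `rᵢ` and a negative
value `-β` on a ray `rⱼ` of a cone, subdivide the cone along `β rᵢ + α rⱼ`, where the form
vanishes (`MonomialCubeChart.stellar`); the number of rays with nonzero value drops, so `n` rounds
suffice (`comparable_of_mem_descend`), and comparabilities already achieved survive further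
subdivisions because `Eᵀ` is monotone for `E ≥ 0` (`Comparable.colForm`).  The measure-theoretic
bookkeeping is `IsGoodFamily.flatMap`.

Sources: R. Goward, *A simple algorithm for principalization of monomial ideals*, Trans. AMS 357
(2005), §2; W. Fulton, *Introduction to toric varieties* (1993), §2.6.  Only `det ≠ 0` is
produced (no unimodularity), which is what real-analytic cube charts need.
-/

noncomputable section

open Set MeasureTheory

namespace Literature.AlgebraicGeometry.Resolution

namespace MonomialCubeChart

variable {n : ℕ}

/-! ## Pulled-back exponents -/

/-- `colForm A a j = Σᵢ A i j · aᵢ = (Aᵀ a)ⱼ`: the exponent of the `j`-th new variable in the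
pull-back `μ_A^* y^a = v^{Aᵀ a}` of the monomial `y^a`. [folklore] -/
def colForm (A : Matrix (Fin n) (Fin n) ℕ) (a : Fin n → ℕ) : Fin n → ℕ :=
  fun j => ∑ i, A i j * a i

/-- `(AE)ᵀ a = Eᵀ (Aᵀ a)`. [folklore] -/
theorem colForm_mul (A E : Matrix (Fin n) (Fin n) ℕ) (a : Fin n → ℕ) :
    colForm (A * E) a = colForm E (colForm A a) := by
  funext j
  simp only [colForm, Matrix.mul_apply, Finset.sum_mul]
  rw [Finset.sum_comm]
  refine Finset.sum_congr rfl fun k _ => ?_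
  rw [Finset.mul_sum]
  refine Finset.sum_congr rfl fun i _ => ?_
  ring

/-- `Eᵀ` is monotone for the componentwise order (entries are natural numbers). [folklore] -/
theorem colForm_mono (E : Matrix (Fin n) (Fin n) ℕ) {u w : Fin n → ℕ} (h : ∀ j, u j ≤ w j) :
    ∀ j, colForm E u j ≤ colForm E w j :=
  fun _ => Finset.sum_le_sum fun i _ => Nat.mul_le_mul_left _ (h i)

/-- The stellar matrix changes only the `i`-th pulled-back exponent, to `β uᵢ + α uⱼ`.
[folklore] -/
theorem colForm_stellar_self (i j : Fin n) (β α : ℕ) (u : Fin n → ℕ) :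
    colForm (stellar i j β α) u i = β * u i + α * u j := by
  simp only [colForm, stellar_apply, if_true, Pi.add_apply, Pi.single_apply, add_mul, ite_mul,
    zero_mul, Finset.sum_add_distrib, Finset.sum_ite_eq', Finset.mem_univ, if_true]

/-- The stellar matrix does not change the pulled-back exponents off `i`. [folklore] -/
theorem colForm_stellar_ne {i j l : Fin n} (hl : l ≠ i) (β α : ℕ) (u : Fin n → ℕ) :
    colForm (stellar i j β α) u l = u l := by
  simp only [colForm, stellar_apply, if_neg hl, Matrix.one_apply, ite_mul, one_mul, zero_mul,
    Finset.sum_ite_eq', Finset.mem_univ, if_true]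

/-- Componentwise comparability of two exponent vectors (`u ≤ w` or `w ≤ u`), i.e. one of the
monomials `v^u`, `v^w` divides the other. [folklore] -/
def Comparable (u w : Fin n → ℕ) : Prop := (∀ j, u j ≤ w j) ∨ (∀ j, w j ≤ u j)

/-- Comparability is preserved under pull-back by any exponent matrix. [folklore] -/
theorem Comparable.colForm (E : Matrix (Fin n) (Fin n) ℕ) {u w : Fin n → ℕ}
    (h : Comparable u w) : Comparable (colForm E u) (colForm E w) :=
  h.imp (colForm_mono E) (colForm_mono E)

/-! ## The refinement algorithm -/

/-- A **conflict** of the pair `(a, b)` on the chart `A`: indices `p = (i, j)` with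
`(Aᵀb)ᵢ < (Aᵀa)ᵢ` and `(Aᵀa)ⱼ < (Aᵀb)ⱼ`, i.e. the linear form `⟨a - b, ·⟩` changes sign on the
cone of `A` (positive on the ray `i`, negative on the ray `j`). [folklore] -/
def IsConflict (a b : Fin n → ℕ) (A : Matrix (Fin n) (Fin n) ℕ) (p : Fin n × Fin n) : Prop :=
  colForm A b p.1 < colForm A a p.1 ∧ colForm A a p.2 < colForm A b p.2

/-- Conflicts are decidable (comparisons of natural numbers). [folklore] -/
instance (a b : Fin n → ℕ) (A : Matrix (Fin n) (Fin n) ℕ) : DecidablePred (IsConflict a b A) :=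
  fun _ => by unfold IsConflict; infer_instance

/-- One refinement step for the pair `(a, b)` at the chart `A`, as exponent matrices relative to
`A`: if `⟨a - b, ·⟩` changes sign on the cone of `A`, with values `α > 0` on ray `i` and `-β < 0`
on ray `j` (a chosen conflict `(i, j)`; both differences below are positive by `IsConflict`, so
the natural-number subtractions are genuine), the stellar pair along the ray `β rᵢ + α rⱼ`, on
which the form vanishes; otherwise the identity. [folklore] -/
def kidsCore (a b : Fin n → ℕ) (A : Matrix (Fin n) (Fin n) ℕ) : List (Matrix (Fin n) (Fin n) ℕ) :=
  if h : ∃ p, IsConflict a b A p then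
    [stellar h.choose.1 h.choose.2 (colForm A b h.choose.2 - colForm A a h.choose.2)
        (colForm A a h.choose.1 - colForm A b h.choose.1),
      stellar h.choose.2 h.choose.1 (colForm A a h.choose.1 - colForm A b h.choose.1)
        (colForm A b h.choose.2 - colForm A a h.choose.2)]
  else [1]

/-- One refinement step for the pair `(a, b)` at the chart `A` (absolute charts `A * E`).
[folklore] -/
def kids (a b : Fin n → ℕ) (A : Matrix (Fin n) (Fin n) ℕ) : List (Matrix (Fin n) (Fin n) ℕ) :=
  (kidsCore a b A).map (A * ·)

/-- `k` rounds of refinement steps for the pair `(a, b)` below the chart `A`. [folklore] -/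
def descend (a b : Fin n → ℕ) : ℕ → Matrix (Fin n) (Fin n) ℕ → List (Matrix (Fin n) (Fin n) ℕ)
  | 0, A => [A]
  | k + 1, A => (kids a b A).flatMap (fun B => descend a b k B)

/-- Refine a family successively for a list of pairs of exponent vectors (`n` rounds each).
[folklore] -/
def run : List ((Fin n → ℕ) × (Fin n → ℕ)) → List (Matrix (Fin n) (Fin n) ℕ) →
    List (Matrix (Fin n) (Fin n) ℕ)
  | [], L => L
  | p :: ps, L => run ps (L.flatMap (fun A => descend p.1 p.2 n A))

/-- The relative charts of one refinement step form a good family. [folklore] -/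
theorem isGoodFamily_kidsCore (a b : Fin n → ℕ) (A : Matrix (Fin n) (Fin n) ℕ) :
    IsGoodFamily (kidsCore a b A) := by
  unfold kidsCore
  split_ifs with h
  · obtain ⟨h1, h2⟩ := h.choose_spec
    have hne : h.choose.1 ≠ h.choose.2 := by
      intro heq
      rw [heq] at h1
      exact lt_asymm h1 h2
    exact isGoodFamily_stellar_pair hne (Nat.sub_ne_zero_of_lt h1) (Nat.sub_ne_zero_of_lt h2)
  · exact isGoodFamily_one

/-- One refinement step preserves good families. [folklore] -/
theorem IsGoodFamily.flatMap_kids {L : List (Matrix (Fin n) (Fin n) ℕ)} (hL : IsGoodFamily L)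
    (a b : Fin n → ℕ) : IsGoodFamily (L.flatMap (kids a b)) :=
  hL.flatMap (kids a b) (kidsCore a b) (fun A _ => isGoodFamily_kidsCore a b A) (fun _ _ => rfl)

/-- `descend` preserves good families. [folklore] -/
theorem IsGoodFamily.flatMap_descend (a b : Fin n → ℕ) :
    ∀ (k : ℕ) {L : List (Matrix (Fin n) (Fin n) ℕ)},
      IsGoodFamily L → IsGoodFamily (L.flatMap (fun A => descend a b k A))
  | 0, L, hL => by simpa [descend] using hL
  | k + 1, L, hL => by
    have h : L.flatMap (fun A => descend a b (k + 1) A) =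
        (L.flatMap (kids a b)).flatMap (fun B => descend a b k B) := by
      rw [List.flatMap_assoc]
      rfl
    rw [h]
    exact IsGoodFamily.flatMap_descend a b k (hL.flatMap_kids a b)

/-- `run` preserves good families. [folklore] -/
theorem isGoodFamily_run :
    ∀ (ps : List ((Fin n → ℕ) × (Fin n → ℕ))) {L : List (Matrix (Fin n) (Fin n) ℕ)},
      IsGoodFamily L → IsGoodFamily (run ps L)
  | [], _, hL => hL
  | p :: ps, _, hL => isGoodFamily_run ps (hL.flatMap_descend p.1 p.2 n)

/-- Every chart produced by `kids` below `A` is of the form `A * E`. [folklore] -/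
theorem exists_eq_mul_of_mem_kids (a b : Fin n → ℕ) (A C : Matrix (Fin n) (Fin n) ℕ)
    (hC : C ∈ kids a b A) : ∃ E, C = A * E := by
  unfold kids at hC
  rw [List.mem_map] at hC
  obtain ⟨E, _, rfl⟩ := hC
  exact ⟨E, rfl⟩

/-- Every chart produced by `descend` below `A` is of the form `A * E`. [folklore] -/
theorem exists_eq_mul_of_mem_descend (a b : Fin n → ℕ) :
    ∀ (k : ℕ) (A C : Matrix (Fin n) (Fin n) ℕ), C ∈ descend a b k A → ∃ E, C = A * E
  | 0, A, C, h => ⟨1, by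
      have hC : C = A := by simpa [descend] using h
      rw [hC, Matrix.mul_one]⟩
  | k + 1, A, C, h => by
    simp only [descend, List.mem_flatMap] at h
    obtain ⟨B, hB, hC⟩ := h
    obtain ⟨E, rfl⟩ := exists_eq_mul_of_mem_kids a b A B hB
    obtain ⟨E', rfl⟩ := exists_eq_mul_of_mem_descend a b k _ C hC
    exact ⟨E * E', Matrix.mul_assoc _ _ _⟩

/-- Comparability achieved at `A` persists on every chart of `descend` below `A`. [folklore] -/
theorem comparable_of_mem_descend_of_comparable (a b : Fin n → ℕ) {a' b' : Fin n → ℕ} (k : ℕ)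
    (A : Matrix (Fin n) (Fin n) ℕ) (h : Comparable (colForm A a') (colForm A b')) :
    ∀ C ∈ descend a b k A, Comparable (colForm C a') (colForm C b') := by
  intro C hC
  obtain ⟨E, rfl⟩ := exists_eq_mul_of_mem_descend a b k A C hC
  rw [colForm_mul, colForm_mul]
  exact h.colForm E

/-- The **discrepancy** of the pair `(a, b)` on the chart `A`: the number of rays of the cone of
`A` on which the linear form `⟨a - b, ·⟩` does not vanish. [folklore] -/
def discr (a b : Fin n → ℕ) (A : Matrix (Fin n) (Fin n) ℕ) : ℕ :=
  (Finset.univ.filter fun j => colForm A a j ≠ colForm A b j).card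

/-- The discrepancy is at most `n`. [folklore] -/
theorem discr_le (a b : Fin n → ℕ) (A : Matrix (Fin n) (Fin n) ℕ) : discr a b A ≤ n :=
  (Finset.card_filter_le _ _).trans (by simp)

/-- The discrepancy is symmetric. [folklore] -/
theorem discr_comm (a b : Fin n → ℕ) (A : Matrix (Fin n) (Fin n) ℕ) : discr a b A = discr b a A := by
  unfold discr
  congr 1
  ext j
  simp only [Finset.mem_filter, Finset.mem_univ, true_and]
  exact ne_comm

/-- No conflict means the two pulled-back exponent vectors are comparable. [folklore] -/
theorem comparable_of_not_exists_isConflict {a b : Fin n → ℕ} {A : Matrix (Fin n) (Fin n) ℕ}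
    (h : ¬ ∃ p, IsConflict a b A p) : Comparable (colForm A a) (colForm A b) := by
  by_contra hc
  simp only [Comparable, not_or, not_forall, not_le] at hc
  obtain ⟨⟨j, hj⟩, ⟨i, hi⟩⟩ := hc
  exact h ⟨(j, i), hj, hi⟩

/-- The arithmetic behind the stellar step: with `α = x - y > 0`, `β = q - p > 0` one has
`β x + α p = β y + α q`, i.e. the form vanishes on the new ray. [folklore] -/
theorem stellar_identity {x y p q : ℕ} (hxy : y < x) (hpq : p < q) :
    (q - p) * x + (x - y) * p = (q - p) * y + (x - y) * q := by
  obtain ⟨c, rfl⟩ := Nat.exists_eq_add_of_lt hxy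
  obtain ⟨d, rfl⟩ := Nat.exists_eq_add_of_lt hpq
  have e1 : y + c + 1 - y = c + 1 := by omega
  have e2 : p + d + 1 - p = d + 1 := by omega
  rw [e1, e2]
  ring

/-- A stellar step at a conflict lowers the discrepancy. [folklore] -/
theorem discr_mul_stellar_lt (a b : Fin n → ℕ) (A : Matrix (Fin n) (Fin n) ℕ) {i j : Fin n}
    (h1 : colForm A b i < colForm A a i) (h2 : colForm A a j < colForm A b j) :
    discr a b (A * stellar i j (colForm A b j - colForm A a j) (colForm A a i - colForm A b i)) <
      discr a b A := by
  have hij : i ≠ j := by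
    intro h
    rw [h] at h1
    exact lt_asymm h1 h2
  unfold discr
  apply Finset.card_lt_card
  rw [Finset.ssubset_iff_of_subset]
  · refine ⟨i, by simp [h1.ne'], ?_⟩
    simp only [Finset.mem_filter, Finset.mem_univ, true_and, not_not, colForm_mul]
    rw [colForm_stellar_self, colForm_stellar_self]
    exact stellar_identity h1 h2
  · intro l hl
    simp only [Finset.mem_filter, Finset.mem_univ, true_and, colForm_mul] at hl ⊢
    by_cases hli : l = i
    · rw [hli]; exact h1.ne'
    · rwa [colForm_stellar_ne hli, colForm_stellar_ne hli] at hl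

/-- **Termination and correctness of `descend`.** If the discrepancy of `(a, b)` at `A` is at
most `k`, then on every chart of `descend a b k A` the pulled-back exponents of `a` and `b` are
comparable. [folklore] -/
theorem comparable_of_mem_descend (a b : Fin n → ℕ) :
    ∀ (k : ℕ) (A : Matrix (Fin n) (Fin n) ℕ), discr a b A ≤ k →
      ∀ C ∈ descend a b k A, Comparable (colForm C a) (colForm C b)
  | 0, A, hk, C, hC => by
    have hC' : C = A := by simpa [descend] using hC
    subst hC'
    have h0 : (Finset.univ.filter fun j => colForm C a j ≠ colForm C b j) = ∅ :=
      Finset.card_eq_zero.1 (Nat.le_zero.1 hk)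
    left
    intro j
    have hj : ¬ (colForm C a j ≠ colForm C b j) := fun hne => by
      have hmem : j ∈ Finset.univ.filter (fun j => colForm C a j ≠ colForm C b j) := by
        simp [hne]
      rw [h0] at hmem
      simp at hmem
    exact (not_not.1 hj).le
  | k + 1, A, hk, C, hC => by
    simp only [descend, List.mem_flatMap] at hC
    obtain ⟨B, hB, hC⟩ := hC
    unfold kids kidsCore at hB
    split_ifs at hB with h
    · obtain ⟨h1, h2⟩ := h.choose_spec
      simp only [List.map_cons, List.map_nil, List.mem_cons, List.not_mem_nil, or_false] at hB
      rcases hB with rfl | rfl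
      · exact comparable_of_mem_descend a b k _
          (Nat.lt_succ_iff.1 (lt_of_lt_of_le (discr_mul_stellar_lt a b A h1 h2) hk)) C hC
      · refine comparable_of_mem_descend a b k _ (Nat.lt_succ_iff.1 (lt_of_lt_of_le ?_ hk)) C hC
        rw [discr_comm, discr_comm a b A]
        exact discr_mul_stellar_lt b a A h2 h1
    · simp only [List.map_cons, List.map_nil, List.mem_singleton, Matrix.mul_one] at hB
      subst hB
      exact comparable_of_mem_descend_of_comparable a b k _
        (comparable_of_not_exists_isConflict h) C hC

/-- `run` preserves comparabilities holding on the whole input family. [folklore] -/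
theorem comparable_of_mem_run_of_forall (a' b' : Fin n → ℕ) :
    ∀ (ps : List ((Fin n → ℕ) × (Fin n → ℕ))) (L : List (Matrix (Fin n) (Fin n) ℕ)),
      (∀ A ∈ L, Comparable (colForm A a') (colForm A b')) →
        ∀ C ∈ run ps L, Comparable (colForm C a') (colForm C b')
  | [], _, h => h
  | p :: ps, _, h => comparable_of_mem_run_of_forall a' b' ps _ (fun B hB => by
      rw [List.mem_flatMap] at hB
      obtain ⟨A, hA, hB⟩ := hB
      exact comparable_of_mem_descend_of_comparable p.1 p.2 n A (h A hA) B hB)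

/-- **Correctness of `run`.** Every listed pair is comparable on every output chart. [folklore] -/
theorem comparable_of_mem_run :
    ∀ (ps : List ((Fin n → ℕ) × (Fin n → ℕ))) (L : List (Matrix (Fin n) (Fin n) ℕ)),
      ∀ C ∈ run ps L, ∀ p ∈ ps, Comparable (colForm C p.1) (colForm C p.2)
  | [], _, _, _, p, hp => absurd hp List.not_mem_nil
  | q :: ps, L, C, hC, p, hp => by
    rw [List.mem_cons] at hp
    rcases hp with rfl | hp
    · refine comparable_of_mem_run_of_forall p.1 p.2 ps _ (fun B hB => ?_) C hC
      rw [List.mem_flatMap] at hB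
      obtain ⟨A, hA, hB⟩ := hB
      exact comparable_of_mem_descend p.1 p.2 n A (discr_le p.1 p.2 A) B hB
    · exact comparable_of_mem_run ps _ C hC p hp

/-! ## Main theorem -/

/-- **Simplicial toric charts making finitely many monomials pairwise comparable** (Goward-type
principalization of pairs of monomials by weighted stellar subdivisions; Fulton 1993 §2.6, Goward
2005 §2, in multiplicative coordinates on the open cube).  For a finite set `S ⊆ ℕⁿ` of exponent
vectors there are finitely many exponent matrices `A_c ∈ ℕ^{n×n}` with `det A_c ≠ 0` whose
monomial maps `v ↦ (∏ⱼ vⱼ^{A_c i j})ᵢ` have pairwise disjoint images of the open unit cube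
covering it up to a Lebesgue-null set, such that on each chart the pulled-back exponent vectors
`A_cᵀ a` (`a ∈ S`) are pairwise comparable componentwise. [folklore] -/
theorem exists_cube_charts_pairwise_comparable (n : ℕ) (S : Finset (Fin n → ℕ)) :
    ∃ (M : ℕ) (A : Fin M → Matrix (Fin n) (Fin n) ℕ),
      (∀ c, ((A c).map (fun t : ℕ => (t : ℝ))).det ≠ 0) ∧
      Pairwise (fun c c' => Disjoint
        ((fun v : Fin n → ℝ => fun i => ∏ j, v j ^ A c i j) ''
          Set.pi Set.univ (fun _ : Fin n => Set.Ioo (0:ℝ) 1))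
        ((fun v : Fin n → ℝ => fun i => ∏ j, v j ^ A c' i j) ''
          Set.pi Set.univ (fun _ : Fin n => Set.Ioo (0:ℝ) 1))) ∧
      MeasureTheory.volume (Set.pi Set.univ (fun _ : Fin n => Set.Ioo (0:ℝ) 1) \
        ⋃ c, (fun v : Fin n → ℝ => fun i => ∏ j, v j ^ A c i j) ''
          Set.pi Set.univ (fun _ : Fin n => Set.Ioo (0:ℝ) 1)) = 0 ∧
      ∀ c, ∀ a ∈ S, ∀ b ∈ S, (∀ j, ∑ i, A c i j * a i ≤ ∑ i, A c i j * b i) ∨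
        (∀ j, ∑ i, A c i j * b i ≤ ∑ i, A c i j * a i) := by
  have hgood : IsGoodFamily (run (S ×ˢ S).toList [(1 : Matrix (Fin n) (Fin n) ℕ)]) :=
    isGoodFamily_run _ isGoodFamily_one
  have hcomp := comparable_of_mem_run (S ×ˢ S).toList [(1 : Matrix (Fin n) (Fin n) ℕ)]
  generalize run (S ×ˢ S).toList [(1 : Matrix (Fin n) (Fin n) ℕ)] = L at hgood hcomp
  refine ⟨L.length, fun c => L.get c, fun c => hgood.det_ne_zero _ (List.get_mem L c), ?_, ?_, ?_⟩
  · intro c c' hcc'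
    have hpw := List.pairwise_iff_getElem.1 hgood.pairwise_disjoint
    change Disjoint (monoMap (L.get c) '' openCube n) (monoMap (L.get c') '' openCube n)
    rw [List.get_eq_getElem, List.get_eq_getElem]
    rcases lt_or_gt_of_ne (fun h : c.val = c'.val => hcc' (Fin.ext h)) with h | h
    · exact hpw c.1 c'.1 c.2 c'.2 h
    · exact (hpw c'.1 c.1 c'.2 c.2 h).symm
  · change MeasureTheory.volume (openCube n \ ⋃ c, monoMap (L.get c) '' openCube n) = 0
    refine measure_mono_null (fun w hw => ?_) hgood.volume_diff
    refine ⟨hw.1, fun h => hw.2 ?_⟩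
    rw [Set.mem_iUnion₂] at h
    obtain ⟨A, hA, hw'⟩ := h
    obtain ⟨c, rfl⟩ := List.mem_iff_get.1 hA
    exact Set.mem_iUnion.2 ⟨c, hw'⟩
  · intro c a ha b hb
    exact hcomp (L.get c) (List.get_mem L c) (a, b) (by simp [ha, hb])

end MonomialCubeChart

end Literature.AlgebraicGeometry.Resolution

end
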